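import Summits.AtomisticToContinuum.BoseEinsteinCondensation.Theorems.BECThomsonPrincipleGDTransferSeededTransportDefs
import Summits.AtomisticToContinuum.BoseEinsteinCondensation.Theorems.BECThomsonPrincipleGDTransferSeededTorusSobolev
import HarnessLib

/-!
# Route `BECThomsonPrinciple`, crux `GDTransfer` (stmt-AtomisticToContinuum-9482), line `seeded-continuity`
# (skeleton v6): the stub `stub_pairPotentialBound` — the pair-potential bound on kinetic-bounded states

Registered stub `stub_pairPotentialBound : Sig.stub_pairPotentialBound` (`= PairPotentialBound` of
`…SeededTransportDefs.lean`, the analytic heart of the measurable TRANSPORT device of the line): at fixed particle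
number `N = m + 1`, side `L > 0`, support radius `R`, height `B`, kinetic budget `K < ∞` and `ε > 0` there is `η > 0`
such that every measurable radial profile `w ≤ B` vanishing beyond `R` with `∫_{ℝ³} w(|x|) dx ≤ η` has interaction
energy `∫_{cell^N} (Σ_{i<j} w^per(xᵢ − xⱼ)) |Φ|² ≤ ε` on every periodic trial state `Φ` with `∫_{cell^N} |∇Φ|² ≤ K`.

Proof (fibrewise Hölder + periodic Sobolev, no regularity of the profile):

* `PairBound.exists_images_const` — uniformly in the profile, `w^per ≤ C_img(L,R) · B` (comparison with the
  periodisation of the indicator profile `𝟙[r ≤ R]`, bounded by `exists_bound_periodizedPotential`);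
* `PairBound.lintegral_cell_rpow_three_halves_le` — `∫_cell w^per(x − y)^{3/2} dx ≤ D^{1/2} ∫_{ℝ³} w(|z|) dz` for
  `w^per ≤ D` (tiling identity `lintegral_cell_periodizedPotential_sub`);
* `PairBound.lintegral_pair_le` — for one pair `(i,j)`: integrating first over the fibre `xᵢ ∈ cell` at frozen
  other coordinates (`lintegral_cellN_lintegral_update`), the registered helper `torusSobolev_weight_bound`
  (Hölder `3/2 · 3` + `H¹(cell) ⊂ L⁶(cell)`, file `…SeededTorusSobolev.lean`) applied to the `C¹` periodic fibre
  `y ↦ Φ(X[i ↦ y])` (`PeriodicTrialState.contDiff_slice`, `PeriodicTrialState.periodic_slice`, chain rule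
  `gradSqC_slice`) gives `∫_{cell^N} w^per(xᵢ − xⱼ)|Φ|² ≤ Δ · C · (∫_{cell^N} |∇ᵢΦ|² + ∫_{cell^N} |Φ|²)` with
  `Δ = sup_y (∫_cell w^per(· − y)^{3/2})^{2/3}`;
* `PairBound.lintegral_interaction_le` — summing over the `≤ N²` pairs, `|∇ᵢΦ|² ≤ |∇Φ|²` and `∫|Φ|² = 1`:
  total `≤ N² Δ C (K + 1)`;
* `stub_pairPotentialBound` — the choice of `η`: `Δ ≤ ((C_img B)^{1/2} η)^{2/3}`.

References: LiebLoss2001 Thm. 8.3 (Sobolev inequality); LSSY2005 §1.2 (1.16), Ch. 2 (2.1) (the energy form and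
the admissible class); Fournais2020 (1.1) (the periodic problem).
-/

noncomputable section

open MeasureTheory Filter Set
open scoped ENNReal NNReal

namespace Summit.AtomisticToContinuum.BoseEinsteinCondensation.Cruxes.GDTransfer.Seeded

open Literature.MathematicalPhysics.QuantumManyBody.BoseGas

namespace PairBound

variable {L : ℝ}

/-! ### Uniform bounds on the periodised profile -/

/-- **Counting lattice images, uniformly in the profile.** For `L > 0` and a support radius `R` there is
`C_img` such that every profile `w ≤ B` vanishing beyond `R` has `w^per ≤ C_img · B` (compare `w` with
`B · 𝟙[r ≤ R]`, whose periodisation is bounded by `exists_bound_periodizedPotential`). [folklore] -/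
theorem exists_images_const (hL : 0 < L) (R : ℝ) : ∃ Cimg : ℝ≥0, ∀ (w : ℝ → ℝ≥0∞) (B : ℝ),
    (∀ r, w r ≤ ENNReal.ofReal B) → (∀ r, R < r → w r = 0) →
      ∀ x, periodizedPotential w L x ≤ Cimg * ENNReal.ofReal B := by
  set w₀ : ℝ → ℝ≥0∞ := fun r => if r ≤ R then 1 else 0 with hw₀
  have hM : ∀ r, w₀ r ≤ ((1 : ℝ≥0) : ℝ≥0∞) := fun r => by
    by_cases h : r ≤ R <;> simp [hw₀, h]
  have hR : ∀ r, R < r → w₀ r = 0 := fun r hr => by simp [hw₀, not_le.mpr hr]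
  obtain ⟨C, hC⟩ :=
    Summit.AtomisticToContinuum.BoseEinsteinCondensation.Theorems.exists_bound_periodizedPotential hL hM hR
  refine ⟨C, fun w B hwB hwR x => ?_⟩
  have hpt : ∀ r, w r ≤ ENNReal.ofReal B * w₀ r := fun r => by
    by_cases h : r ≤ R
    · simpa [hw₀, h] using hwB r
    · simp [hwR r (not_le.mp h)]
  calc periodizedPotential w L x ≤ periodizedPotential (fun r => ENNReal.ofReal B * w₀ r) L x :=
        ENNReal.tsum_le_tsum fun n => hpt _
    _ = ENNReal.ofReal B * periodizedPotential w₀ L x := ENNReal.tsum_mul_left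
    _ ≤ ENNReal.ofReal B * C := by gcongr; exact hC x
    _ = C * ENNReal.ofReal B := mul_comm _ _

/-- **The `L^{3/2}` mass of a shifted periodised profile on the cell**: if `w^per ≤ D` then
`∫_cell w^per(x − y)^{3/2} dx ≤ D^{1/2} ∫_{ℝ³} w(|z|) dz` (pointwise `P^{3/2} = P · P^{1/2} ≤ P · D^{1/2}` and the
tiling identity `∫_cell w^per(x − y) dx = ∫_{ℝ³} w(|z|) dz`). [folklore] -/
theorem lintegral_cell_rpow_three_halves_le (hL : 0 < L) {w : ℝ → ℝ≥0∞} (hw : Measurable w) {D : ℝ≥0∞}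
    (hD : ∀ x, periodizedPotential w L x ≤ D) (y : Space) :
    ∫⁻ x in cell L, periodizedPotential w L (x - y) ^ ((3 : ℝ) / 2) ≤
      D ^ ((1 : ℝ) / 2) * ∫⁻ z : Space, w ‖z‖ := by
  have hmeas : Measurable fun x : Space => periodizedPotential w L (x - y) :=
    (measurable_periodizedPotential hw L).comp (measurable_id.sub_const y)
  have hpt : ∀ x : Space, periodizedPotential w L (x - y) ^ ((3 : ℝ) / 2) ≤
      periodizedPotential w L (x - y) * D ^ ((1 : ℝ) / 2) := by
    intro x
    rw [show ((3 : ℝ) / 2) = 1 + 1 / 2 by norm_num,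
      ENNReal.rpow_add_of_nonneg _ _ (by norm_num) (by norm_num), ENNReal.rpow_one]
    gcongr
    exact hD _
  calc ∫⁻ x in cell L, periodizedPotential w L (x - y) ^ ((3 : ℝ) / 2)
      ≤ ∫⁻ x in cell L, periodizedPotential w L (x - y) * D ^ ((1 : ℝ) / 2) := lintegral_mono hpt
    _ = (∫⁻ x in cell L, periodizedPotential w L (x - y)) * D ^ ((1 : ℝ) / 2) :=
        lintegral_mul_const _ hmeas
    _ = D ^ ((1 : ℝ) / 2) * ∫⁻ z : Space, w ‖z‖ := by
        rw [lintegral_cell_periodizedPotential_sub hL hw, mul_comm]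

/-! ### One pair: fibrewise Hölder–Sobolev -/

/-- **The bound for one pair `(i, j)`, `i ≠ j`.** Given the Hölder–Sobolev weight bound on the cell with
constant `C` (the registered helper `torusSobolev_weight_bound`) and `(∫_cell w^per(· − y)^{3/2})^{2/3} ≤ Δ` for
all `y`, every periodic trial state satisfies
`∫_{cell^N} w^per(xᵢ − xⱼ)|Φ|² ≤ Δ · C · (∫_{cell^N} |∇ᵢΦ|² + ∫_{cell^N} |Φ|²)`
(integrate first over the fibre `xᵢ ∈ cell` at frozen other coordinates: `lintegral_cellN_lintegral_update`;
the fibre is `C¹` and `Lℤ³`-periodic, and its gradient is the `i`-th partial gradient, `gradSqC_slice`).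
[folklore] -/
theorem lintegral_pair_le (hL : 0 < L) {m : ℕ} (Φ : PeriodicTrialState (m + 1) L) {i j : Fin (m + 1)}
    (hji : j ≠ i) {w : ℝ → ℝ≥0∞} (hw : Measurable w) {C Δ : ℝ≥0∞} (hC : C ≠ ⊤) (hΔ : Δ ≠ ⊤)
    (hS : ∀ W : Space → ℝ≥0∞, Measurable W → ∀ f : Space → ℂ, ContDiff ℝ 1 f →
      (∀ (x : Space) (k : Fin 3), f (x + EuclideanSpace.single k L) = f x) →
      (∫⁻ x in cell L, W x * (‖f x‖₊ : ℝ≥0∞) ^ 2) ≤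
        (∫⁻ x in cell L, W x ^ ((3 : ℝ) / 2)) ^ ((2 : ℝ) / 3) *
          (C * ((∫⁻ x in cell L, gradSqC f x) + ∫⁻ x in cell L, (‖f x‖₊ : ℝ≥0∞) ^ 2)))
    (hA : ∀ y : Space,
      (∫⁻ x in cell L, periodizedPotential w L (x - y) ^ ((3 : ℝ) / 2)) ^ ((2 : ℝ) / 3) ≤ Δ) :
    ∫⁻ X in cellN (m + 1) L, periodizedPotential w L (X i - X j) * (‖Φ.ψ X‖₊ : ℝ≥0∞) ^ 2 ≤
      Δ * C * ((∫⁻ X in cellN (m + 1) L,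
          ∑ k : Fin 3, (‖fderiv ℝ Φ.ψ X (Pi.single i (EuclideanSpace.single k (1 : ℝ)))‖₊ : ℝ≥0∞) ^ 2) +
        ∫⁻ X in cellN (m + 1) L, (‖Φ.ψ X‖₊ : ℝ≥0∞) ^ 2) := by
  set H : Config (m + 1) → ℝ≥0∞ := fun X =>
    periodizedPotential w L (X i - X j) * (‖Φ.ψ X‖₊ : ℝ≥0∞) ^ 2 with hH
  set G : Config (m + 1) → ℝ≥0∞ := fun X =>
    (∑ k : Fin 3, (‖fderiv ℝ Φ.ψ X (Pi.single i (EuclideanSpace.single k (1 : ℝ)))‖₊ : ℝ≥0∞) ^ 2) +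
      (‖Φ.ψ X‖₊ : ℝ≥0∞) ^ 2 with hG
  have hHm : Measurable H :=
    ((measurable_periodizedPotential hw L).comp
      ((measurable_pi_apply i).sub (measurable_pi_apply j))).mul Φ.measurable_normSq
  have hGm : Measurable G := (measurable_gradSqAt i Φ.ψ).add Φ.measurable_normSq
  have hL3 : ENNReal.ofReal L ^ 3 ≠ 0 := pow_ne_zero _ (by simpa using hL)
  have hL3' : ENNReal.ofReal L ^ 3 ≠ ⊤ := ENNReal.pow_ne_top ENNReal.ofReal_ne_top
  have hdiff : Differentiable ℝ Φ.ψ := Φ.contDiff.differentiable one_ne_zero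
  -- the fibrewise estimate at frozen coordinates `X`
  have hfib : ∀ X : Config (m + 1), ∫⁻ x in cell L, H (Function.update X i x) ≤
      Δ * C * ∫⁻ x in cell L, G (Function.update X i x) := by
    intro X
    set f : Space → ℂ := fun y => Φ.ψ (Function.update X i y) with hf
    have hfC : ContDiff ℝ 1 f := Φ.contDiff_slice X i
    have hfper : ∀ (x : Space) (k : Fin 3), f (x + EuclideanSpace.single k L) = f x :=
      fun x k => Φ.periodic_slice X i x k
    have hW : Measurable fun x : Space => periodizedPotential w L (x - X j) :=
      (measurable_periodizedPotential hw L).comp (measurable_id.sub_const _)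
    have h1 : ∀ x, H (Function.update X i x) =
        periodizedPotential w L (x - X j) * (‖f x‖₊ : ℝ≥0∞) ^ 2 := by
      intro x
      simp only [hH, hf, Function.update_self, Function.update_of_ne hji]
    have h2 : ∀ x, G (Function.update X i x) = gradSqC f x + (‖f x‖₊ : ℝ≥0∞) ^ 2 := by
      intro x
      rw [hf, gradSqC_slice hdiff X i x]
    simp only [h1, h2]
    calc ∫⁻ x in cell L, periodizedPotential w L (x - X j) * (‖f x‖₊ : ℝ≥0∞) ^ 2
        ≤ (∫⁻ x in cell L, periodizedPotential w L (x - X j) ^ ((3 : ℝ) / 2)) ^ ((2 : ℝ) / 3) *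
            (C * ((∫⁻ x in cell L, gradSqC f x) + ∫⁻ x in cell L, (‖f x‖₊ : ℝ≥0∞) ^ 2)) :=
          hS _ hW f hfC hfper
      _ ≤ Δ * (C * ((∫⁻ x in cell L, gradSqC f x) + ∫⁻ x in cell L, (‖f x‖₊ : ℝ≥0∞) ^ 2)) := by
          gcongr
          exact hA _
      _ = Δ * C * ∫⁻ x in cell L, (gradSqC f x + (‖f x‖₊ : ℝ≥0∞) ^ 2) := by
          rw [lintegral_add_left (Dyson.measurable_gradSqC hfC), mul_assoc]
  -- integrate over the frozen coordinates
  have hkey : ENNReal.ofReal L ^ 3 * ∫⁻ X in cellN (m + 1) L, H X ≤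
      ENNReal.ofReal L ^ 3 * (Δ * C * ∫⁻ X in cellN (m + 1) L, G X) := by
    calc ENNReal.ofReal L ^ 3 * ∫⁻ X in cellN (m + 1) L, H X
        = ∫⁻ X in cellN (m + 1) L, ∫⁻ x in cell L, H (Function.update X i x) :=
          (lintegral_cellN_lintegral_update i hHm).symm
      _ ≤ ∫⁻ X in cellN (m + 1) L, Δ * C * ∫⁻ x in cell L, G (Function.update X i x) :=
          lintegral_mono hfib
      _ = Δ * C * ∫⁻ X in cellN (m + 1) L, ∫⁻ x in cell L, G (Function.update X i x) :=
          lintegral_const_mul' _ _ (ENNReal.mul_ne_top hΔ hC)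
      _ = ENNReal.ofReal L ^ 3 * (Δ * C * ∫⁻ X in cellN (m + 1) L, G X) := by
          rw [lintegral_cellN_lintegral_update i hGm]; ring
  have h := (ENNReal.mul_le_mul_iff_right hL3 hL3').1 hkey
  simp only [hH, hG] at h
  rw [lintegral_add_left (measurable_gradSqAt i Φ.ψ)] at h
  exact h

/-! ### All pairs -/

/-- **The interaction energy of a kinetic-bounded state**: with `C`, `Δ` as in `lintegral_pair_le`,
`∫_{cell^N} (Σ_{i<j} w^per(xᵢ − xⱼ)) |Φ|² ≤ N · N · (Δ · C · (∫_{cell^N} |∇Φ|² + 1))`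
(`|∇ᵢΦ|² ≤ |∇Φ|²`, `∫_{cell^N} |Φ|² = 1`, at most `N²` pairs). [folklore] -/
theorem lintegral_interaction_le (hL : 0 < L) {m : ℕ} (Φ : PeriodicTrialState (m + 1) L)
    {w : ℝ → ℝ≥0∞} (hw : Measurable w) {C Δ : ℝ≥0∞} (hC : C ≠ ⊤) (hΔ : Δ ≠ ⊤)
    (hS : ∀ W : Space → ℝ≥0∞, Measurable W → ∀ f : Space → ℂ, ContDiff ℝ 1 f →
      (∀ (x : Space) (k : Fin 3), f (x + EuclideanSpace.single k L) = f x) →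
      (∫⁻ x in cell L, W x * (‖f x‖₊ : ℝ≥0∞) ^ 2) ≤
        (∫⁻ x in cell L, W x ^ ((3 : ℝ) / 2)) ^ ((2 : ℝ) / 3) *
          (C * ((∫⁻ x in cell L, gradSqC f x) + ∫⁻ x in cell L, (‖f x‖₊ : ℝ≥0∞) ^ 2)))
    (hA : ∀ y : Space,
      (∫⁻ x in cell L, periodizedPotential w L (x - y) ^ ((3 : ℝ) / 2)) ^ ((2 : ℝ) / 3) ≤ Δ) :
    ∫⁻ X in cellN (m + 1) L, periodicInteraction w L X * (‖Φ.ψ X‖₊ : ℝ≥0∞) ^ 2 ≤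
      ((m + 1 : ℕ) : ℝ≥0∞) * (((m + 1 : ℕ) : ℝ≥0∞) *
        (Δ * C * ((∫⁻ X in cellN (m + 1) L, kineticDensity Φ.ψ X) + 1))) := by
  classical
  -- one pair
  have hpair : ∀ i j : Fin (m + 1), i < j →
      ∫⁻ X in cellN (m + 1) L, periodizedPotential w L (X i - X j) * (‖Φ.ψ X‖₊ : ℝ≥0∞) ^ 2 ≤
        Δ * C * ((∫⁻ X in cellN (m + 1) L, kineticDensity Φ.ψ X) + 1) := by
    intro i j hij
    refine (lintegral_pair_le hL Φ hij.ne' hw hC hΔ hS hA).trans ?_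
    gcongr with X
    · rw [kineticDensity_eq_sum_gradSqAt]
      exact Finset.single_le_sum (f := fun i' => ∑ k : Fin 3,
        (‖fderiv ℝ Φ.ψ X (Pi.single i' (EuclideanSpace.single k (1 : ℝ)))‖₊ : ℝ≥0∞) ^ 2)
        (fun _ _ => bot_le) (Finset.mem_univ i)
    · exact Φ.norm_eq.le
  -- measurability of the pair terms
  have hmeas : ∀ i j : Fin (m + 1), Measurable fun X : Config (m + 1) =>
      periodizedPotential w L (X i - X j) * (‖Φ.ψ X‖₊ : ℝ≥0∞) ^ 2 := fun i j =>
    ((measurable_periodizedPotential hw L).comp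
      ((measurable_pi_apply i).sub (measurable_pi_apply j))).mul Φ.measurable_normSq
  -- sum over the pairs
  set c : ℝ≥0∞ := Δ * C * ((∫⁻ X in cellN (m + 1) L, kineticDensity Φ.ψ X) + 1) with hc
  calc ∫⁻ X in cellN (m + 1) L, periodicInteraction w L X * (‖Φ.ψ X‖₊ : ℝ≥0∞) ^ 2
      = ∫⁻ X in cellN (m + 1) L, ∑ i : Fin (m + 1), ∑ j : Fin (m + 1) with i < j,
          periodizedPotential w L (X i - X j) * (‖Φ.ψ X‖₊ : ℝ≥0∞) ^ 2 := by
        refine lintegral_congr fun X => ?_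
        rw [periodicInteraction, Finset.sum_mul]
        exact Finset.sum_congr rfl fun i _ => Finset.sum_mul _ _ _
    _ = ∑ i : Fin (m + 1), ∑ j : Fin (m + 1) with i < j,
          ∫⁻ X in cellN (m + 1) L, periodizedPotential w L (X i - X j) * (‖Φ.ψ X‖₊ : ℝ≥0∞) ^ 2 := by
        rw [lintegral_finsetSum _ fun i _ => Finset.measurable_sum _ fun j _ => hmeas i j]
        exact Finset.sum_congr rfl fun i _ => lintegral_finsetSum _ fun j _ => hmeas i j
    _ ≤ ∑ i : Fin (m + 1), ∑ j : Fin (m + 1) with i < j, c :=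
        Finset.sum_le_sum fun i _ => Finset.sum_le_sum fun j hj => hpair i j (Finset.mem_filter.1 hj).2
    _ ≤ ∑ _i : Fin (m + 1), ∑ _j : Fin (m + 1), c :=
        Finset.sum_le_sum fun i _ => Finset.sum_le_sum_of_subset (Finset.filter_subset _ _)
    _ = ((m + 1 : ℕ) : ℝ≥0∞) * (((m + 1 : ℕ) : ℝ≥0∞) * c) := by
        simp only [Finset.sum_const, Finset.card_univ, Fintype.card_fin, nsmul_eq_mul]

end PairBound

open PairBound

/-- **Stub (D) `stub_pairPotentialBound`: the pair-potential bound on kinetic-bounded states.** At fixed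
`N = m + 1`, `L > 0`, `R`, `B`, `K < ∞` and `ε > 0` there is `η > 0` such that every measurable radial profile
`w ≤ B` vanishing beyond `R` with `∫_{ℝ³} w(|x|) dx ≤ η` has `∫_{cell^N} (Σ_{i<j} w^per(xᵢ − xⱼ)) |Φ|² ≤ ε` on every
periodic trial state `Φ` with `∫_{cell^N} |∇Φ|² ≤ K`.  Fibrewise Hölder `L^{3/2} · L³` in one particle coordinate at
frozen others and the periodic Sobolev inequality `H¹(cell) ⊂ L⁶(cell)` (`torusSobolev_weight_bound`), finitely
many lattice images (`PairBound.exists_images_const`) and `‖w^per(· − y)‖_{3/2} ≤ (C_img B)^{1/3} η^{2/3}`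
(`PairBound.lintegral_cell_rpow_three_halves_le`). [cite: LiebLoss2001, Thm. 8.3] -/
theorem stub_pairPotentialBound : Sig.stub_pairPotentialBound := by
  intro m L hL R B K hK ε hε
  obtain ⟨C, hC, hS⟩ := torusSobolev_weight_bound L hL
  obtain ⟨Cimg, hCimg⟩ := exists_images_const hL R
  -- the constants
  set N : ℝ≥0∞ := ((m + 1 : ℕ) : ℝ≥0∞) with hN
  set Q : ℝ≥0∞ := N * (N * (C * (K + 1))) with hQ
  have hNtop : N ≠ ⊤ := ENNReal.natCast_ne_top _
  have hQtop : Q ≠ ⊤ := ENNReal.mul_ne_top hNtop (ENNReal.mul_ne_top hNtop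
    (ENNReal.mul_ne_top hC (ENNReal.add_ne_top.2 ⟨hK, ENNReal.one_ne_top⟩)))
  have hQ1 : Q + 1 ≠ 0 := by simp
  have hQ1' : Q + 1 ≠ ⊤ := ENNReal.add_ne_top.2 ⟨hQtop, ENNReal.one_ne_top⟩
  -- the target for `Δ`
  set δ₀ : ℝ≥0∞ := ENNReal.ofReal ε / (Q + 1) with hδ₀
  have hδ₀pos : 0 < δ₀ := ENNReal.div_pos_iff.2 ⟨(ENNReal.ofReal_pos.2 hε).ne', hQ1'⟩
  have hδ₀top : δ₀ ≠ ⊤ := (ENNReal.div_lt_top ENNReal.ofReal_ne_top hQ1).ne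
  have hQδ : Q * δ₀ ≤ ENNReal.ofReal ε := by
    calc Q * δ₀ ≤ (Q + 1) * δ₀ := by gcongr; exact le_self_add
      _ = ENNReal.ofReal ε := ENNReal.mul_div_cancel hQ1 hQ1'
  -- the bound `D` of the periodisation and the target for `∫ w`
  set D : ℝ≥0∞ := (Cimg : ℝ≥0∞) * ENNReal.ofReal B with hD
  have hDtop : D ^ ((1 : ℝ) / 2) ≠ ⊤ :=
    ENNReal.rpow_ne_top_of_nonneg (by norm_num) (ENNReal.mul_ne_top ENNReal.coe_ne_top ENNReal.ofReal_ne_top)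
  have hD1 : D ^ ((1 : ℝ) / 2) + 1 ≠ 0 := by simp
  have hD1' : D ^ ((1 : ℝ) / 2) + 1 ≠ ⊤ := ENNReal.add_ne_top.2 ⟨hDtop, ENNReal.one_ne_top⟩
  set η₀ : ℝ≥0∞ := δ₀ ^ ((3 : ℝ) / 2) / (D ^ ((1 : ℝ) / 2) + 1) with hη₀
  have hη₀pos : 0 < η₀ := ENNReal.div_pos_iff.2 ⟨(ENNReal.rpow_pos hδ₀pos hδ₀top).ne', hD1'⟩
  have hη₀top : η₀ ≠ ⊤ :=
    (ENNReal.div_lt_top (ENNReal.rpow_ne_top_of_nonneg (by norm_num) hδ₀top) hD1).ne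
  have hDη : D ^ ((1 : ℝ) / 2) * η₀ ≤ δ₀ ^ ((3 : ℝ) / 2) := by
    calc D ^ ((1 : ℝ) / 2) * η₀ ≤ (D ^ ((1 : ℝ) / 2) + 1) * η₀ := by gcongr; exact le_self_add
      _ = δ₀ ^ ((3 : ℝ) / 2) := ENNReal.mul_div_cancel hD1 hD1'
  refine ⟨η₀.toReal, ENNReal.toReal_pos hη₀pos.ne' hη₀top, fun w hw hwB hwR hint Φ hkin => ?_⟩
  rw [ENNReal.ofReal_toReal hη₀top] at hint
  -- `Δ := δ₀` works
  have hper : ∀ x, periodizedPotential w L x ≤ D := hCimg w B hwB hwR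
  have hA : ∀ y : Space,
      (∫⁻ x in cell L, periodizedPotential w L (x - y) ^ ((3 : ℝ) / 2)) ^ ((2 : ℝ) / 3) ≤ δ₀ := by
    intro y
    have h1 : ∫⁻ x in cell L, periodizedPotential w L (x - y) ^ ((3 : ℝ) / 2) ≤ δ₀ ^ ((3 : ℝ) / 2) :=
      calc ∫⁻ x in cell L, periodizedPotential w L (x - y) ^ ((3 : ℝ) / 2)
          ≤ D ^ ((1 : ℝ) / 2) * ∫⁻ z : Space, w ‖z‖ := lintegral_cell_rpow_three_halves_le hL hw hper y
        _ ≤ D ^ ((1 : ℝ) / 2) * η₀ := by gcongr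
        _ ≤ δ₀ ^ ((3 : ℝ) / 2) := hDη
    calc (∫⁻ x in cell L, periodizedPotential w L (x - y) ^ ((3 : ℝ) / 2)) ^ ((2 : ℝ) / 3)
        ≤ (δ₀ ^ ((3 : ℝ) / 2)) ^ ((2 : ℝ) / 3) := ENNReal.rpow_le_rpow h1 (by norm_num)
      _ = δ₀ := by
          rw [← ENNReal.rpow_mul, show ((3 : ℝ) / 2) * (2 / 3) = 1 by norm_num, ENNReal.rpow_one]
  calc ∫⁻ X in cellN (m + 1) L, periodicInteraction w L X * (‖Φ.ψ X‖₊ : ℝ≥0∞) ^ 2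
      ≤ N * (N * (δ₀ * C * ((∫⁻ X in cellN (m + 1) L, kineticDensity Φ.ψ X) + 1))) :=
        lintegral_interaction_le hL Φ hw hC hδ₀top hS hA
    _ ≤ N * (N * (δ₀ * C * (K + 1))) := by gcongr
    _ = Q * δ₀ := by rw [hQ]; ring
    _ ≤ ENNReal.ofReal ε := hQδ

end Summit.AtomisticToContinuum.BoseEinsteinCondensation.Cruxes.GDTransfer.Seeded

end
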